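import Summits.Ventures.CertifiedManyBodySolver.Observables.RungLeaves
import Summits.Ventures.CertifiedManyBodySolver.Observables.PairLROTorusCeilingRow
import HarnessLib

/-!
# Ventures/CertifiedManyBodySolver — Observables/RungLeavesSummit.lean

HONEST FRAMING: first certified bounds on pairing observables; not a superconductivity verdict; every number certified (two
lineages + referee) or labelled float. hubbard-obs cell (D-0042), rung R2(a) / M3′-obs at `(U, n, t′) = (8, 7/8, 0)`; obs-lit seat, additive to
`Observables/RungLeaves.lean` (p405324) on hubbard-obs-p1's LEAVES CHECK (STATUS 19:26:14Z (c): "hang BOTH readings on the F₂ edge — the TL Bragg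
weight AND the summit-format `liminf` of `HubbardSuperconductivity`'s own LRO sequence"). Zero compute; no certificate; no `sorry`.

**The SUMMIT-FORMAT ODLRO leaf.** `Observables/RungLeaves.lean` states the ODLRO target on the thermodynamic-limit STATES (`braggWeight μ 0 ≤ c`
for every torus limit `ω` and every measure representing `r ↦ ω.dWavePairCorr 0 r`). This file adds the twin on the FINITE TORI, in the format of the
summit `HubbardSuperconductivity` (which asserts `liminf > 0` of exactly this sequence for SOME `U, δ`):
* `M3ObsPairLROCeilingAt_tp0 c` — for EVERY family `ψ_L` of unit `(rectN (7/8) L, S^z = 0)`-sector ground states of `hubbardTorusTT' L 1 0 8`,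
  `liminf_k |Λ_{2k}|⁻² Σ_{x,y∈Λ_{2k}} P_d(2k; x, y) ≤ c` (`torusPullback (pairFieldCorr g_d ψ)` on `halfOpenBox 2 (2k)`, the even sides — verbatim the
  conclusion of hubbard-obs-p1's `m3_liminf_dWavePairFieldLRO_le_of_orbitLowerRow_neg`, Observables/PairLROTorusCeilingRow.lean, p405359);
  **`M3ObsPairLROCeiling_tp0`** = `c = 1/2` (the same threshold as `M3ObsODLROCeiling_tp0`; OPEN at filing time, decided by the rung-0b `F2up` edges);
* `M3ObsPairLROCeilingAt_tp0_of_orbitRow` — a certified `D₄`-ORBIT cell on the negated box pair word `−Σ_{x,y∈B} Φ_x†Φ_y` (tonight's `F2up` claim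
  nodes, after their floor hypothesis is discharged by #473) plus the cap cell `M3EnergyUpperRow 0 hi`, `hi ≤ u`, give the leaf at every
  `c ≥ −q/|B|²` (p405359: compactness `exists_isTorusLimitOf_subseq` on the even sides → row at the limit → kinematic domination of the orbit-averaged box
  functional over the pair-field density, PairLROTorusDictionary; NO certificate identity and no `D₄`-invariance assumption enter);
* `M3ObsPairLROCeilingAt_tp0_mono`; and the JOINT discharger `M3Obs_odlro_and_pairLRO_of_orbitRow` (one orbit cell ⇒ both ODLRO leaves at `−q/|B|²`).
Every proof offered is CONDITIONAL ON THE CLAIM NODES (cap #354 / floor #473 / the F₂ node as explicit hypotheses BY NAME; obs-ref O-D(d5)).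
HONEST: «normalisation-limited» at `R = 2` (≥ 0.22 for the exact state) — never informative versus the printed `m_d² ≲ 1.3·10⁻³` (t′ = 0; obs-lit
PRINTED.md §A3); a ceiling neither proves nor refutes the summit.
References: D. J. Scalapino, Phys. Rep. 250 (1995) 329, §2 eq. (2.4) [Scalapino1995]; G. L. Sewell, Phys. Rep. 57 (1980) 307 / J. Stat. Phys. 4 (1970), §4 [Sewell1970].
-/

noncomputable section

namespace Summit.Ventures.CertifiedManyBodySolver.Observables

open Matrix Finset Literature.MathematicalPhysics.QuantumLattice Literature.Probability.LatticeModels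
open Literature.MathematicalPhysics.QuantumLattice.HubbardWave0 ThermodynamicLimit Filter Topology
open Literature.MathematicalPhysics.QuantumManyBody.StateRelaxation
open scoped ComplexOrder BigOperators

/-- **A certified ceiling `c` on the SUMMIT's `d`-wave pair-field LRO sequence** at `(8, 7/8, 0)`: for every family `ψ_L` of unit
`(rectN (7/8) L, S^z = 0)`-sector ground states of `hubbardTorusTT' L 1 0 8`,
`liminf_k |Λ_{2k}|⁻² Σ_{x,y∈Λ_{2k}} P_d(2k; x, y) ≤ c` (the box-averaged torus pair-field correlator of `HubbardSuperconductivity`, even sides).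
[cite: Scalapino1995, §2 eq. (2.4)] -/
def M3ObsPairLROCeilingAt_tp0 (c : ℚ) : Prop :=
  ∀ (ψ : ∀ L, Fock (Orb (FermionTorus 2 L))),
    (∀ L, IsGroundStateInSector (hubbardTorusTT' L 1 0 8) (rectN (7 / 8) L) 0 (ψ L)) →
    (∀ L, star (ψ L) ⬝ᵥ ψ L = 1) →
    liminf (fun k : ℕ => (∑ x ∈ halfOpenBox 2 (2 * k), ∑ y ∈ halfOpenBox 2 (2 * k),
        torusPullback (pairFieldCorr dWaveFormFactor ψ) (2 * k) x y) /
          ((#(halfOpenBox 2 (2 * k)) : ℝ)) ^ 2) atTop ≤ ((c : ℚ) : ℝ)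

/-- **LEAF `M3ObsPairLROCeiling_tp0`** = the summit-format ODLRO ceiling `1/2` (same threshold as `M3ObsODLROCeiling_tp0` of RungLeaves.lean).
OPEN at filing time (2026-08-25); decided by the rung-0b `F2up` edges. HONEST: «normalisation-limited». -/
@[conjecture] def M3ObsPairLROCeiling_tp0 : Prop :=
  M3ObsPairLROCeilingAt_tp0 (1 / 2)

/-- Monotone transport. -/
theorem M3ObsPairLROCeilingAt_tp0_mono {c c' : ℚ} (h : M3ObsPairLROCeilingAt_tp0 c) (hcc : c ≤ c') :
    M3ObsPairLROCeilingAt_tp0 c' :=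
  fun ψ hψ hψ1 => (h ψ hψ hψ1).trans (by exact_mod_cast hcc)

/-- **Certified orbit row on the negated box pair word ⇒ the summit-format leaf** at every `c ≥ −q/|B|²` — hubbard-obs-p1's
`m3_liminf_dWavePairFieldLRO_le_of_orbitLowerRow_neg` (p405359) at `S = univ`. [cite: Scalapino1995, §2 eq. (2.4)] -/
theorem M3ObsPairLROCeilingAt_tp0_of_orbitRow {u hi q c : ℚ} {B : Finset (Site 2)} (hB : B.Nonempty)
    (h : M3CorrOrbitLowerRow 0 u q Finset.univ (B.biUnion (pairRegion (insert (0 : Site 2) unitSteps)))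
      (-pairBoxWord (insert (0 : Site 2) unitSteps) dWaveFormFactor B))
    (hE : M3EnergyUpperRow 0 hi) (hhi : hi ≤ u) (hc : -((q : ℚ) : ℝ) / ((B.card : ℝ)) ^ 2 ≤ ((c : ℚ) : ℝ)) :
    M3ObsPairLROCeilingAt_tp0 c :=
  fun ψ hψ hψ1 =>
    (m3_liminf_dWavePairFieldLRO_le_of_orbitLowerRow_neg (S := Finset.univ) (Finset.mem_univ _) hB h hE hhi ψ hψ hψ1).trans hc

/-- **One certified `F₂`-type orbit cell discharges BOTH ODLRO leaves at `c = any rational ≥ −q/|B|²`**: the thermodynamic-limit Bragg-weight leaf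
`M3ObsODLROCeilingAt_tp0 c` (RungLeaves.lean, via p402180) AND the summit-format leaf `M3ObsPairLROCeilingAt_tp0 c` (via p405359). -/
theorem M3Obs_odlro_and_pairLRO_of_orbitRow {u hi q c : ℚ} {B : Finset (Site 2)} (hB : B.Nonempty)
    (h : M3CorrOrbitLowerRow 0 u q Finset.univ (B.biUnion (pairRegion (insert (0 : Site 2) unitSteps)))
      (-pairBoxWord (insert (0 : Site 2) unitSteps) dWaveFormFactor B))
    (hE : M3EnergyUpperRow 0 hi) (hhi : hi ≤ u) (hc : -((q : ℚ) : ℝ) / ((B.card : ℝ)) ^ 2 ≤ ((c : ℚ) : ℝ)) :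
    M3ObsODLROCeilingAt_tp0 c ∧ M3ObsPairLROCeilingAt_tp0 c :=
  ⟨M3ObsODLROCeilingAt_tp0_of_orbitRow hB h hE hhi hc, M3ObsPairLROCeilingAt_tp0_of_orbitRow hB h hE hhi hc⟩

end Summit.Ventures.CertifiedManyBodySolver.Observables

end
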